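import Summits.QuantumFields.BalabanUV.Beta.AveragingLinearGaugeVH
import Summits.QuantumFields.BalabanUV.Beta.AveragingWardRootedKernels

/-!
# `GAN24.BorderGaugeLegContact` — the FLUCTUATION-slot (table-leg) pure-gauge law of an1's rooted border table `vhSAt ρ`, PACKED and PAIRED:
# `Σ_α (V κ′ u (x − e_α) z (inl α) (inr μ) − V κ′ u x z (inl α) (inr μ)) = ([u + e_{κ′} = x] − [z + ρ + L·e_μ = x]) · q¹,ρ` — NO Maxwell operator

HONEST FRAMING (cell charter, verbatim): «discharging `BetaPertH` makes Bałaban's UV stability UNCONDITIONAL — a real constructive-QFT result;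
it is NOT the continuum limit and NOT the Clay problem.»  DERIVED cell leaf (pub-balaban, G-an2-4 formalisation swarm → CRUX TEAM (2), seat
`b2b-balaban-gan24-formalise-leaf-02`, gen 47), answering the row owner's LOCATED QUESTION X-gan24p1-g19-1 (`CT3-MECHANISM-v1.2.md` §D (D2a):
«state and prove the pure-gauge-leg identity of `vhSAt` on its field legs») in the part an2-g30 located as NOT in the tree ([AN2-G30-W2]: «the PACKED
`MKer`-level statements»).  [folklore] PACKAGING of an1's kernel-level Ward law BY NAME — nothing of an1's is restated, no estimate, no limit, nothing
cited, no `[cite:]` tag, no `def`, no `def … : Prop`; it instantiates NO binder of the β-function wall and discharges NO letter of (CONV-C).  NEVER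
«G-an2-4 closed»; NOT hS0, NOT D1, NOT `BetaPertH`, NOT continuum, NOT Clay.  «not in print; our bookkeeping».
HONEST DEPENDENCY (cell records, verbatim): «continuum YM on T⁴ ⇐ BetaPertH ∧ nine spine estimates (0/9 proved); BetaPertH ⇐ (D1) ∧ (D4) ∧ CAP+tail;
G-an2-4 gates asym, D1 and NE2/3/4.»
ABSOLUTE RULE (cell charter, verbatim): «No internally-minted statement may enter as a cited fact. Every hypothesis is either kernel-proved in this
package or a verbatim quotation of a PUBLISHED theorem with page reference. The manuscript(s) under audit are NOT citable for their own disputed steps —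
they are the thing under adjudication; programme-internal (2001/route/tribunal) claims are never citable.»

THE OBJECTS (generic `d`, fine lattice `ℤ^(d+1)`, blocking `L ≥ 1`, root offset `ρ`; `e_κ := AffineAveraging.unitVec κ = Pi.single κ 1`
(`= B6BondElimination.unitVec κ`, `AveragingWardStencils.b6UnitVec_eq`)).  an1's ROOTED BORDER (field–multiplier, (V-H)) TABLE
`V := AveragingHessianKernelsRooted.vhSAt ρ d L` — a stencil family indexed by the BACKGROUND fine bond `(κ′, u)` whose kernel `V κ′ u : MKer` carries,
on the `(inl α, inr μ)` block, the FLUCTUATION field leg `(α, x)` and the MULTIPLIER leg of the coarse bond `(μ, z/L)` packed at the fine image `z`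
(`packVH`; value `m^ρ_{(μ, z/L)}((α, x), (κ′, u)) = vhKerAt ρ L μ (blk L z) (α, x) (κ′, u)`), and the symmetric twin on `(inr μ, inl α)`.  an1's packed
rooted FIRST-ORDER averaging kernel `q¹,ρ` is `AveragingWardRootedStencils.linSymAt ρ L` (same slots).
WHICH LEG.  `V` has two FIELD legs — the fluctuation slot and the background-bond family index — and one multiplier leg.  The family-index (INDEX-leg)
pure-gauge law is an1's (S-V)ρ `AveragingWardRootedStencils.divV_vhSAt_apply` (TREE; its linear-gauge letter `LinearGaugeVH.tsum_vhSAt_eq`).  THIS FILE is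
the OTHER field leg — the FLUCTUATION slot — i.e. the CT-1 analogue («what the table returns against a pure-gauge fluctuation `dψ`»), which the CT-ROUTE's
contact analysis of the border-born sectors needs (owner's v1.2 §D (D2a)); at kernel level it is an1's (K-V1)ρ `AveragingWardRootedKernels.vhKerAt_div_left`
(TREE), here read through node 7a's packer.
## What is proved ([folklore]; `r₊(z) := z + ρ + L·e_μ` = the FAR endpoint of the coarse bond `(μ, z/L)` from its root, on the packer's support `z ∈ L·ℤ^(d+1)`)
* §1 ENTRYWISE: **`gaugeLeg_vhSAt_inl_inr`** `Σ_α (V κ′ u (x − e_α) z (inl α) (inr μ) − V κ′ u x z (inl α) (inr μ)) = ([u + e_{κ′} = x] − [r₊(z) = x]) ·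
  linSymAt ρ L u z (inl κ′) (inr μ)` — the pure-gauge fluctuation `d(δ_x)` returns the packed FIRST-ORDER kernel `q¹,ρ_{(μ,z/L)}(κ′, u)` weighted by the TIP
  indicator of the background bond minus the indicator of the far endpoint of the coarse bond (the letter shadow of `Q′(λ_tip·B)_b − λ(b₊)·(Q′B)_b`, a
  `[Q′, m_λ]`-type commutator; NO curl–curl operator, unlike CT-1's Wilson law); the `(inr μ, inl α)` twin **`gaugeLeg_vhSAt_inr_inl`**; vanishing off the two
  contact sites (`…_eq_zero`).
* §2 PAIRED WITH ANY GAUGE FUNCTION `ψ` (two nonzero terms, no hypothesis on `ψ` or `ρ`): **`gaugeLeg_vhSAt_tsum`**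
  `Σ'_x ψ x · Σ_α (V κ′ u (x − e_α) z … − V κ′ u x z …) = (ψ(u + e_{κ′}) − ψ(r₊(z))) · linSymAt ρ L u z (inl κ′) (inr μ)`, twin `gaugeLeg_vhSAt_tsum_right`.
* §3 THE `dψ`-FORMS (box root `ρ = toSite r`, `r ∈ box`, where the table is finitely supported in its fluctuation slot — `vhKerAt_eq_zero_left`):
  **`tsum_dz_mul_vhSAt`** `Σ'_x Σ_α (dz ψ) α x · V κ′ u x z (inl α) (inr μ) = (ψ(u + e_{κ′}) − ψ(r₊(z))) · linSymAt ρ L u z (inl κ′) (inr μ)` and the twin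
  **`tsum_vhSAt_mul_dz`** (fluctuation in the second slot).
NOT HERE: the Hessian table `hessFFAt` and the Λ-piece `SLam` (sequel `GAN24.HessianGaugeLegContact`); the (0.4)-symmetrised tables `symVhSAt` (an1's
functional law `SymAveragingWardRooted.symSkewVHAt_grad_left` exists; packing on request); any contact CELL (owner's CT-3m design).
Provenance: seat b2b-balaban-gan24-formalise-leaf-02 gen 47 (prover-…-leaf-02-g47-0), 2026-08-21; over an1's node 7aρ∕8ρ files named above BY NAME.
-/

open Finset
open scoped BigOperators
open Literature.MathematicalPhysics.QuantumFieldTheory.Balaban1983to89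
open Literature.MathematicalPhysics.QuantumFieldTheory.Balaban1983to89.Beta
open AffineAveraging AveragingContours AveragingHessianKernels AveragingContoursRooted AveragingHessianKernelsRooted
open AveragingWardStencils (b6UnitVec_eq)
open ExpKernelCalculus (MKer)
open OneStepResolventKernel (Fib)
open Summit.QuantumFields.BalabanUV.Beta.AveragingWardRootedStencils (linSymAt linSymAt_inl_inr linSymAt_inr_inl)
open Summit.QuantumFields.BalabanUV.Beta.AveragingWardRootedKernels (vhKerAt_div_left)
open Summit.QuantumFields.BalabanUV.Beta.LinearGaugeVH (nearBox mem_nearBox summable_of_finsupp)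

noncomputable section

namespace Summit.QuantumFields.BalabanUV.Beta.GAN24.BorderGaugeLegContact

variable {d : ℕ}

/-! ## §1 The entrywise fluctuation-slot law -/

section Entry

/-- [folklore] **THE FLUCTUATION-SLOT PURE-GAUGE LAW OF THE ROOTED BORDER TABLE, `(inl α, inr μ)` BLOCK**: for the background bond `(κ′, u)`, the varied
fluctuation site `x` and the multiplier leg `(μ, z)`,
`Σ_α (vhSAt ρ κ′ u (x − e_α) z (inl α) (inr μ) − vhSAt ρ κ′ u x z (inl α) (inr μ)) = ([u + e_{κ′} = x] − [z + ρ + L·e_μ = x]) · linSymAt ρ L u z (inl κ′) (inr μ)`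
— an1's (K-V1)ρ `vhKerAt_div_left` read through node 7a's packer (on its support `z = L • blk L z`, so the far endpoint of the coarse bond from the root is
`z + ρ + L·e_μ`). -/
theorem gaugeLeg_vhSAt_inl_inr {L : ℕ} (hL : 1 ≤ L) (ρ : Fin (d + 1) → ℤ) (κ' : Fin (d + 1)) (u x z : Fin (d + 1) → ℤ) (μ : Fin (d + 1)) :
    (∑ α, (vhSAt ρ d L rfl κ' u (x - unitVec α) z (Sum.inl α) (Sum.inr μ) - vhSAt ρ d L rfl κ' u x z (Sum.inl α) (Sum.inr μ)))
      = ((if u + unitVec κ' = x then 1 else 0) - (if z + ρ + (L : ℤ) • unitVec μ = x then 1 else 0))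
        * linSymAt ρ L u z (Sum.inl κ') (Sum.inr μ) := by
  simp only [vhSAt, packVH_inl_inr, linSymAt_inl_inr]
  by_cases hz : off L z = 0
  · simp only [hz, if_true]
    rw [vhKerAt_div_left hL, ← eq_smul_blk_of_off_eq_zero hL hz]
  · simp [hz]

/-- [folklore] **THE `(inr μ, inl α)` BLOCK** (the packer's symmetric twin: fluctuation leg in the SECOND slot at `z`, multiplier leg packed at `x`):
`Σ_α (vhSAt ρ κ′ u x (z − e_α) (inr μ) (inl α) − vhSAt ρ κ′ u x z (inr μ) (inl α)) = ([u + e_{κ′} = z] − [x + ρ + L·e_μ = z]) · linSymAt ρ L x u (inr μ) (inl κ′)`. -/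
theorem gaugeLeg_vhSAt_inr_inl {L : ℕ} (hL : 1 ≤ L) (ρ : Fin (d + 1) → ℤ) (κ' : Fin (d + 1)) (u x z : Fin (d + 1) → ℤ) (μ : Fin (d + 1)) :
    (∑ α, (vhSAt ρ d L rfl κ' u x (z - unitVec α) (Sum.inr μ) (Sum.inl α) - vhSAt ρ d L rfl κ' u x z (Sum.inr μ) (Sum.inl α)))
      = ((if u + unitVec κ' = z then 1 else 0) - (if x + ρ + (L : ℤ) • unitVec μ = z then 1 else 0))
        * linSymAt ρ L x u (Sum.inr μ) (Sum.inl κ') := by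
  simp only [vhSAt, packVH_inr_inl, linSymAt_inr_inl]
  by_cases hx : off L x = 0
  · simp only [hx, if_true]
    rw [vhKerAt_div_left hL, ← eq_smul_blk_of_off_eq_zero hL hx]
  · simp [hx]

/-- [folklore] The fluctuation-slot variation vanishes on the field–field block (so does the table). -/
theorem gaugeLeg_vhSAt_inl_inl (ρ : Fin (d + 1) → ℤ) (L : ℕ) (κ' : Fin (d + 1)) (u x z : Fin (d + 1) → ℤ) (α' : Fin (d + 1)) :
    (∑ α, (vhSAt ρ d L rfl κ' u (x - unitVec α) z (Sum.inl α) (Sum.inl α') - vhSAt ρ d L rfl κ' u x z (Sum.inl α) (Sum.inl α'))) = 0 := by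
  simp [vhSAt]

/-- [folklore] Off the two contact sites (`u + e_{κ′}` and `z + ρ + L·e_μ`) the `(inl, inr)` variation vanishes. -/
theorem gaugeLeg_vhSAt_inl_inr_eq_zero {L : ℕ} (hL : 1 ≤ L) {ρ : Fin (d + 1) → ℤ} {κ' : Fin (d + 1)} {u x z : Fin (d + 1) → ℤ}
    {μ : Fin (d + 1)} (hu : u + unitVec κ' ≠ x) (hz : z + ρ + (L : ℤ) • unitVec μ ≠ x) :
    (∑ α, (vhSAt ρ d L rfl κ' u (x - unitVec α) z (Sum.inl α) (Sum.inr μ) - vhSAt ρ d L rfl κ' u x z (Sum.inl α) (Sum.inr μ))) = 0 := by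
  rw [gaugeLeg_vhSAt_inl_inr hL, if_neg hu, if_neg hz, sub_zero, zero_mul]

/-- [folklore] Off the two contact sites the `(inr, inl)` variation vanishes. -/
theorem gaugeLeg_vhSAt_inr_inl_eq_zero {L : ℕ} (hL : 1 ≤ L) {ρ : Fin (d + 1) → ℤ} {κ' : Fin (d + 1)} {u x z : Fin (d + 1) → ℤ}
    {μ : Fin (d + 1)} (hu : u + unitVec κ' ≠ z) (hx : x + ρ + (L : ℤ) • unitVec μ ≠ z) :
    (∑ α, (vhSAt ρ d L rfl κ' u x (z - unitVec α) (Sum.inr μ) (Sum.inl α) - vhSAt ρ d L rfl κ' u x z (Sum.inr μ) (Sum.inl α))) = 0 := by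
  rw [gaugeLeg_vhSAt_inr_inl hL, if_neg hu, if_neg hx, sub_zero, zero_mul]

end Entry

/-! ## §2 Paired with any gauge function (summation over the varied site: two nonzero terms) -/

section Paired

/-- [folklore] Kronecker pairing over the whole lattice: `Σ'_x ψ x · ([a = x] − [b = x]) · c = (ψ a − ψ b) · c`. -/
theorem tsum_mul_ite_sub_ite_mul (ψ : (Fin (d + 1) → ℤ) → ℝ) (a b : Fin (d + 1) → ℤ) (c : ℝ) :
    ∑' x, ψ x * (((if a = x then (1 : ℝ) else 0) - (if b = x then 1 else 0)) * c) = (ψ a - ψ b) * c := by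
  have h1 : ∀ x, ψ x * (((if a = x then (1 : ℝ) else 0) - (if b = x then 1 else 0)) * c)
      = (if x = a then ψ a * c else 0) - (if x = b then ψ b * c else 0) := by
    intro x
    by_cases ha : x = a
    · subst ha
      by_cases hb : x = b
      · subst hb; simp
      · have hb' : ¬ b = x := fun h => hb h.symm
        simp [hb, hb']
    · have ha' : ¬ a = x := fun h => ha h.symm
      by_cases hb : x = b
      · subst hb; simp [ha, ha']
      · have hb' : ¬ b = x := fun h => hb h.symm
        simp [ha, ha', hb, hb']
  have hs1 : Summable fun x : Fin (d + 1) → ℤ => (if x = a then ψ a * c else 0) :=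
    summable_of_finsupp {a} fun x hx => by rw [Finset.mem_singleton] at hx; simp [hx]
  have hs2 : Summable fun x : Fin (d + 1) → ℤ => (if x = b then ψ b * c else 0) :=
    summable_of_finsupp {b} fun x hx => by rw [Finset.mem_singleton] at hx; simp [hx]
  rw [tsum_congr h1, Summable.tsum_sub hs1 hs2, tsum_ite_eq, tsum_ite_eq]
  ring

/-- [folklore] **THE FLUCTUATION-SLOT LAW PAIRED WITH ANY GAUGE FUNCTION**, `(inl, inr)` block:
`Σ'_x ψ x · Σ_α (vhSAt ρ κ′ u (x − e_α) z (inl α) (inr μ) − vhSAt ρ κ′ u x z (inl α) (inr μ)) = (ψ(u + e_{κ′}) − ψ(z + ρ + L·e_μ)) · linSymAt ρ L u z (inl κ′) (inr μ)`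
— TIP value of `ψ` on the background bond minus its value at the FAR endpoint of the coarse bond, against `q¹,ρ`; for EVERY `ψ` and every root. -/
theorem gaugeLeg_vhSAt_tsum {L : ℕ} (hL : 1 ≤ L) (ρ : Fin (d + 1) → ℤ) (κ' : Fin (d + 1)) (u z : Fin (d + 1) → ℤ) (μ : Fin (d + 1))
    (ψ : (Fin (d + 1) → ℤ) → ℝ) :
    ∑' x, ψ x * ∑ α, (vhSAt ρ d L rfl κ' u (x - unitVec α) z (Sum.inl α) (Sum.inr μ) - vhSAt ρ d L rfl κ' u x z (Sum.inl α) (Sum.inr μ))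
      = (ψ (u + unitVec κ') - ψ (z + ρ + (L : ℤ) • unitVec μ)) * linSymAt ρ L u z (Sum.inl κ') (Sum.inr μ) := by
  simp only [gaugeLeg_vhSAt_inl_inr hL]
  exact tsum_mul_ite_sub_ite_mul ψ _ _ _

/-- [folklore] **… `(inr, inl)` block** (fluctuation in the second slot):
`Σ'_z ψ z · Σ_α (vhSAt ρ κ′ u x (z − e_α) (inr μ) (inl α) − vhSAt ρ κ′ u x z (inr μ) (inl α)) = (ψ(u + e_{κ′}) − ψ(x + ρ + L·e_μ)) · linSymAt ρ L x u (inr μ) (inl κ′)`. -/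
theorem gaugeLeg_vhSAt_tsum_right {L : ℕ} (hL : 1 ≤ L) (ρ : Fin (d + 1) → ℤ) (κ' : Fin (d + 1)) (u x : Fin (d + 1) → ℤ) (μ : Fin (d + 1))
    (ψ : (Fin (d + 1) → ℤ) → ℝ) :
    ∑' z, ψ z * ∑ α, (vhSAt ρ d L rfl κ' u x (z - unitVec α) (Sum.inr μ) (Sum.inl α) - vhSAt ρ d L rfl κ' u x z (Sum.inr μ) (Sum.inl α))
      = (ψ (u + unitVec κ') - ψ (x + ρ + (L : ℤ) • unitVec μ)) * linSymAt ρ L x u (Sum.inr μ) (Sum.inl κ') := by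
  simp only [gaugeLeg_vhSAt_inr_inl hL]
  exact tsum_mul_ite_sub_ite_mul ψ _ _ _

end Paired

/-! ## §3 The `dψ`-forms (box root: the table is finitely supported in its fluctuation slot) -/

section Dz

/-- [folklore] For a box root the `(inl, inr)` entry vanishes unless the fluctuation site lies in the support box of the multiplier leg's block
(`vhKerAt_eq_zero_left` through the packer). -/
theorem vhSAt_inl_inr_eq_zero_of_not_mem {L : ℕ} {r : Fin (d + 1) → ℕ} (hr : r ∈ box (d + 1) L) (κ' : Fin (d + 1)) (u z : Fin (d + 1) → ℤ)
    (α μ : Fin (d + 1)) {x : Fin (d + 1) → ℤ} (hx : x ∉ nearBox L (blk L z)) :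
    vhSAt (toSite r) d L rfl κ' u x z (Sum.inl α) (Sum.inr μ) = 0 := by
  rw [mem_nearBox] at hx
  simp only [vhSAt, packVH_inl_inr]
  split_ifs
  · exact vhKerAt_eq_zero_left hr (f := (α, x)) hx _
  · rfl

/-- [folklore] The same for the `(inr, inl)` entry (fluctuation site `z`, multiplier block of `x`). -/
theorem vhSAt_inr_inl_eq_zero_of_not_mem {L : ℕ} {r : Fin (d + 1) → ℕ} (hr : r ∈ box (d + 1) L) (κ' : Fin (d + 1)) (u x : Fin (d + 1) → ℤ)
    (μ α : Fin (d + 1)) {z : Fin (d + 1) → ℤ} (hz : z ∉ nearBox L (blk L x)) :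
    vhSAt (toSite r) d L rfl κ' u x z (Sum.inr μ) (Sum.inl α) = 0 := by
  rw [mem_nearBox] at hz
  simp only [vhSAt, packVH_inr_inl]
  split_ifs
  · exact vhKerAt_eq_zero_left hr (f := (α, z)) hz _
  · rfl

/-- [folklore] Any function times the `(inl, inr)` entry is summable over the fluctuation site (finite support). -/
theorem summable_mul_vhSAt {L : ℕ} {r : Fin (d + 1) → ℕ} (hr : r ∈ box (d + 1) L) (κ' : Fin (d + 1)) (u z : Fin (d + 1) → ℤ)
    (α μ : Fin (d + 1)) (g : (Fin (d + 1) → ℤ) → ℝ) :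
    Summable fun x => g x * vhSAt (toSite r) d L rfl κ' u x z (Sum.inl α) (Sum.inr μ) :=
  summable_of_finsupp (nearBox L (blk L z)) fun x hx => by rw [vhSAt_inl_inr_eq_zero_of_not_mem hr κ' u z α μ hx, mul_zero]

/-- [folklore] Any function times the `(inr, inl)` entry is summable over the second-slot site (finite support). -/
theorem summable_mul_vhSAt_right {L : ℕ} {r : Fin (d + 1) → ℕ} (hr : r ∈ box (d + 1) L) (κ' : Fin (d + 1)) (u x : Fin (d + 1) → ℤ)
    (μ α : Fin (d + 1)) (g : (Fin (d + 1) → ℤ) → ℝ) :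
    Summable fun z => g z * vhSAt (toSite r) d L rfl κ' u x z (Sum.inr μ) (Sum.inl α) :=
  summable_of_finsupp (nearBox L (blk L x)) fun z hz => by rw [vhSAt_inr_inl_eq_zero_of_not_mem hr κ' u x μ α hz, mul_zero]

/-- [folklore] Summation by parts over the whole lattice, one direction at a time: for a family `F α x` such that `x ↦ g x · F α x` is summable for every `g`,
`Σ'_x Σ_α (ψ(x + e_α) − ψ x) · F α x = Σ'_x ψ x · Σ_α (F α (x − e_α) − F α x)`. -/
theorem tsum_sum_dz_mul_eq (F : Fin (d + 1) → (Fin (d + 1) → ℤ) → ℝ) (hF : ∀ α (g : (Fin (d + 1) → ℤ) → ℝ), Summable fun x => g x * F α x)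
    (ψ : (Fin (d + 1) → ℤ) → ℝ) :
    ∑' x, ∑ α, dz ψ α x * F α x = ∑' x, ψ x * ∑ α, (F α (x - unitVec α) - F α x) := by
  have hs1 : ∀ α, Summable fun x => ψ (x + unitVec α) * F α x := fun α => hF α (fun x => ψ (x + unitVec α))
  have hs2 : ∀ α, Summable fun x => ψ x * F α x := fun α => hF α ψ
  have hs3 : ∀ α, Summable fun x => ψ x * F α (x - unitVec α) := by
    intro α
    have h := (Equiv.subRight (unitVec α)).summable_iff.2 (hs1 α)
    refine h.congr fun x => ?_
    simp only [Function.comp_apply, Equiv.subRight_apply, sub_add_cancel]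
  have hshift : ∀ α, ∑' x, ψ (x + unitVec α) * F α x = ∑' x, ψ x * F α (x - unitVec α) := by
    intro α
    rw [← (Equiv.subRight (unitVec α)).tsum_eq (fun x => ψ (x + unitVec α) * F α x)]
    refine tsum_congr fun x => ?_
    simp only [Equiv.subRight_apply, sub_add_cancel]
  have hL : ∀ x, ∑ α, dz ψ α x * F α x = ∑ α, (ψ (x + unitVec α) * F α x - ψ x * F α x) := by
    intro x
    refine Finset.sum_congr rfl fun α _ => ?_
    rw [dz]; ring
  have hR : ∀ x, ψ x * ∑ α, (F α (x - unitVec α) - F α x) = ∑ α, (ψ x * F α (x - unitVec α) - ψ x * F α x) := by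
    intro x
    rw [Finset.mul_sum]
    refine Finset.sum_congr rfl fun α _ => ?_
    ring
  rw [tsum_congr hL, tsum_congr hR, Summable.tsum_finsetSum (fun α _ => (hs1 α).sub (hs2 α)),
    Summable.tsum_finsetSum (fun α _ => (hs3 α).sub (hs2 α))]
  refine Finset.sum_congr rfl fun α _ => ?_
  rw [(hs1 α).tsum_sub (hs2 α), (hs3 α).tsum_sub (hs2 α), hshift α]

/-- [folklore] **THE `dψ`-FORM OF THE FLUCTUATION-SLOT LAW** (box root `ρ = toSite r`, `r ∈ box`): a pure-gauge fluctuation `(dz ψ)_α(x) = ψ(x + e_α) − ψ x`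
inserted in the border table's fluctuation slot gives
`Σ'_x Σ_α (dz ψ) α x · vhSAt ρ κ′ u x z (inl α) (inr μ) = (ψ(u + e_{κ′}) − ψ(z + ρ + L·e_μ)) · linSymAt ρ L u z (inl κ′) (inr μ)`, for EVERY `ψ`. -/
theorem tsum_dz_mul_vhSAt {L : ℕ} (hL : 1 ≤ L) {r : Fin (d + 1) → ℕ} (hr : r ∈ box (d + 1) L) (κ' : Fin (d + 1)) (u z : Fin (d + 1) → ℤ)
    (μ : Fin (d + 1)) (ψ : (Fin (d + 1) → ℤ) → ℝ) :
    ∑' x, ∑ α, dz ψ α x * vhSAt (toSite r) d L rfl κ' u x z (Sum.inl α) (Sum.inr μ)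
      = (ψ (u + unitVec κ') - ψ (z + toSite r + (L : ℤ) • unitVec μ)) * linSymAt (toSite r) L u z (Sum.inl κ') (Sum.inr μ) := by
  rw [tsum_sum_dz_mul_eq (fun α x => vhSAt (toSite r) d L rfl κ' u x z (Sum.inl α) (Sum.inr μ))
    (fun α g => summable_mul_vhSAt hr κ' u z α μ g) ψ]
  exact gaugeLeg_vhSAt_tsum hL (toSite r) κ' u z μ ψ

/-- [folklore] **THE `dψ`-FORM, SECOND SLOT**: `Σ'_z Σ_α vhSAt ρ κ′ u x z (inr μ) (inl α) · (dz ψ) α z = (ψ(u + e_{κ′}) − ψ(x + ρ + L·e_μ)) · linSymAt ρ L x u (inr μ) (inl κ′)`. -/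
theorem tsum_vhSAt_mul_dz {L : ℕ} (hL : 1 ≤ L) {r : Fin (d + 1) → ℕ} (hr : r ∈ box (d + 1) L) (κ' : Fin (d + 1)) (u x : Fin (d + 1) → ℤ)
    (μ : Fin (d + 1)) (ψ : (Fin (d + 1) → ℤ) → ℝ) :
    ∑' z, ∑ α, vhSAt (toSite r) d L rfl κ' u x z (Sum.inr μ) (Sum.inl α) * dz ψ α z
      = (ψ (u + unitVec κ') - ψ (x + toSite r + (L : ℤ) • unitVec μ)) * linSymAt (toSite r) L x u (Sum.inr μ) (Sum.inl κ') := by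
  have h : ∀ z, ∑ α, vhSAt (toSite r) d L rfl κ' u x z (Sum.inr μ) (Sum.inl α) * dz ψ α z
      = ∑ α, dz ψ α z * vhSAt (toSite r) d L rfl κ' u x z (Sum.inr μ) (Sum.inl α) := fun z => Finset.sum_congr rfl fun α _ => mul_comm _ _
  rw [tsum_congr h, tsum_sum_dz_mul_eq (fun α z => vhSAt (toSite r) d L rfl κ' u x z (Sum.inr μ) (Sum.inl α))
    (fun α g => summable_mul_vhSAt_right hr κ' u x μ α g) ψ]
  exact gaugeLeg_vhSAt_tsum_right hL (toSite r) κ' u x μ ψ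

/-- [folklore] The `dψ`-form through the table's symmetry: the second-slot reading equals the first-slot reading with the slots exchanged (`vhSAt_symm`). -/
theorem tsum_vhSAt_mul_dz_eq_symm (ρ : Fin (d + 1) → ℤ) (L : ℕ) (κ' : Fin (d + 1)) (u x : Fin (d + 1) → ℤ) (μ : Fin (d + 1))
    (ψ : (Fin (d + 1) → ℤ) → ℝ) :
    ∑' z, ∑ α, vhSAt ρ d L rfl κ' u x z (Sum.inr μ) (Sum.inl α) * dz ψ α z
      = ∑' z, ∑ α, dz ψ α z * vhSAt ρ d L rfl κ' u z x (Sum.inl α) (Sum.inr μ) := by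
  refine tsum_congr fun z => Finset.sum_congr rfl fun α _ => ?_
  rw [vhSAt_symm ρ L κ' u x z (Sum.inr μ) (Sum.inl α), mul_comm]

end Dz

end Summit.QuantumFields.BalabanUV.Beta.GAN24.BorderGaugeLegContact

end
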